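import Literature.AlgebraicGeometry.Resolution.KangarooAtlasCertCentres

/-!
# Kangaroo atlas certificates, part 3: Bierstone–Milman's year-of-birth exceptional set (rule `bmold`)

Companion to `KangarooAtlasCertCentres.lean` (same sparse model `x^q + F(y₁,…,y_m)` over `𝔽_p`, `F` kept
CLEANED, `shade = ord F − Σ rᵢ`, coordinate-subspace centres `C_S`). Rule `bm` there demands the centre inside
EVERY exceptional component through the point. Bierstone–Milman demand it only inside the components that are
OLD relative to the year of birth of the current invariant value:

* "Let `a ∈ M_j`. Let `i` denote the earliest year in the resolution history where `ι(a) = ι(a_i)` (… the 'year of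
  birth' of `ι(a)`). Set `E¹(a) := {H ∈ E(a) : H is transformed from E(a_i)}`, `s₁(a) := #E¹(a)`. To define
  `s_{r+1}(a)` in general, let `i` be the earliest year where `inv_{r+1/2}(a) = inv_{r+1/2}(a_i)`. Set
  `E^{r+1}(a) := {H ∈ E(a) ∖ (E¹(a) ∪ ⋯ ∪ E^r(a)) : H is transformed from E(a_i)}`"
  [cite: BierstoneMilman2002, Definitions 1.14 (p. 8 of the arXiv text)];
* the old components enter the marked ideal with multiplicity `1` (`𝓗₁(a) := 𝓒₁(a) ∪ (E¹(a)|_{N₁(a)}, 1)`), the new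
  ones (`𝓔₁(a) := E(a) ∖ E¹(a)`) only as the exceptional monomial factored out before `ν₂`
  [cite: BierstoneMilman2002, §3 (p. 14 of the arXiv text)].

Transplant (the atlas' gen-6 rule `bmold`, `pub-rosobs-atlas-g6/ATLAS-SCHEMA-g6.md` §2; implemented twice in Python
as `engineA_cc2.py` / `engineB_cc2.py`, this file is the THIRD implementation on single rows): `ι = ord = q` is
constant along the walk, so `E¹` = the components inherited from the input's exceptional divisor (`e1`); the value
whose year of birth defines `E²` is `(s₁, shade)` (`v`); `must = E¹ ∪ E²` is propagated as: a new component is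
required only if the value `v` CHANGED at the step that created it (then every component through the new point is
required); on a plateau of `v` the previous `must` is inherited (restricted to the components still through the
point). Admissibility is `admissible true … must` — the rule `bm` predicate with `must` in place of `exc`.
Freedoms fixed (ATLAS-SCHEMA-g6 §4): plateau reading of "year of birth" (F17), only `E¹, E²` formed (F19).

Rows certified below (variables indexed `0, 1, 2 = y, z, w`): the two increases that rule `bmold` ADDS on the
`wh4` family (`x² + y³ + z⁶ + w⁶ + yz²w²` over `𝔽₂`, cleaned residual `y³ + yz²w²`, atlas item
`wh4-p2-y3z6w6+y1z2w2`, `KANGAROO-ATLAS-BMOLD.md` §2): after the curve blow-up `C_{y,z}` (chart `z`) the new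
component `E_z` is NOT required (the shade stayed `3`), so the curve `C_{y,w}` is admissible; its blow-up (chart `y`,
translated to `w = 1`) reaches the monomial antelope `y z w²`, `r = (1, 1, 0)`, shade `2`, where the point is the
only admissible centre, and the point blow-up (chart `y`, `z = 1`) INCREASES the shade to `3`. Under rule `bm` the
second centre would have to contain `E_z`, so `C_{y,w}` is refused there. Everything is `decide` (kernel reduction;
no `native_decide`); this is a certificate of a computation, not a theorem about resolution.
-/

namespace Literature.AlgebraicGeometry.Resolution.KangarooAtlasCert

/-- a state of the coordinate-centre walk carrying Bierstone–Milman's year-of-birth data: `e1` = components inherited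
from the input's exceptional divisor and still through the point (`E¹`), `must` = the components the centre must
contain (`E¹ ∪ E²`); `must ⊆ exc`. [cite: BierstoneMilman2002, Definitions 1.14] -/
structure BState where
  F : Poly
  r : List ℕ
  exc : List ℕ
  e1 : List ℕ
  must : List ℕ
  deriving Repr, DecidableEq

/-- forget the year-of-birth data. [folklore] -/
def BState.toC (s : BState) : CState := ⟨s.F, s.r, s.exc⟩

/-- shade of a `BState`. [cite: Hauser2010, §F] -/
def BState.shade (s : BState) : ℕ := ord s.F - s.r.sum

/-- the value `(s₁, shade)` = `inv_{3/2}` of the transplant, whose plateau defines `E²`.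
[cite: BierstoneMilman2002, Definitions 1.14] -/
def BState.v (s : BState) : ℕ × ℕ := (s.e1.length, s.shade)

/-- rule `bmold`: the minimal-cardinality coordinate subspaces `C_S` that are equimultiple, carry the shade at their
general point, and contain every REQUIRED component (`admissible true` with `must` for `exc`).
[cite: BierstoneMilman2002, §3 p. 14] [cite: HauserPerlega2019PRIMS, §2] -/
def bmoldCentres (p q m : ℕ) (s : BState) : List (List ℕ) := admissibleCentres true p q m s.F s.r s.must

/-- one step of the `bmold` walk: `stepS` on the underlying `CState`, then the year-of-birth bookkeeping — `E¹` is
restricted to the components still through the point (never the new one), and `must` is inherited (restricted) if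
`v` is unchanged, else reset to every component through the new point. (engine convention, ATLAS-SCHEMA-g6 §2)
[cite: BierstoneMilman2002, Definitions 1.14] -/
def stepB (p q : ℕ) (s : BState) (S : List ℕ) (j : ℕ) (b : List ℕ) : Option BState :=
  match stepS p q s.toC S j b with
  | none => none
  | some c =>
    let keep : ℕ → Bool := fun i => (b.getD i 0 == 0) && (i != j)
    let e1' := s.e1.filter keep
    let sh' := ord c.F - c.r.sum
    let must' := if (e1'.length, sh') = s.v then s.must.filter keep else c.exc
    some ⟨c.F, c.r, c.exc, e1', must'⟩

/-- the trace `(shade, r, exc, must, centres)` along a list of moves `(S, j, b)`; stops at the first inadmissible move.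
[cite: Hauser2010, §F–§G] -/
def walkTraceB (p q m : ℕ) : BState → List (List ℕ × ℕ × List ℕ) → List (ℕ × List ℕ × List ℕ × List ℕ × List (List ℕ))
  | s, [] => [(s.shade, s.r, s.exc, s.must, bmoldCentres p q m s)]
  | s, (S, j, b) :: rest =>
    (s.shade, s.r, s.exc, s.must, bmoldCentres p q m s) :: (match stepB p q s S j b with
      | none => []
      | some s' => walkTraceB p q m s' rest)

/-- the cleaned residual of `x² + y³ + z⁶ + w⁶ + yz²w²` over `𝔽₂` in `(y, z, w)`: `z⁶ + w⁶ = (z³ + w³)²` is absorbed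
into `x`, leaving `y³ + yz²w²`. [cite: Hauser2010, §D (cleaning)] -/
def wh4F : Poly := [([3, 0, 0], 1), ([1, 2, 2], 1)]

/-- The `bmold` walk that adds a kangaroo (atlas path `/[yz]z:0,0,0/[yw]y:0,0,1/[yzw]y:0,1,0`): root shade `3` with
two admissible curves `C_{y,z}`, `C_{y,w}`; blow up `C_{y,z}` in chart `z` — residual `yzw² + y³z`, `r = (0,1,0)`,
`E_z` through the point but NOT required (`must = []`: shade still `3`), so the admissible centre is the CURVE `C_{y,w}`;
blow it up in chart `y` at `w = 1` — the monomial antelope `yzw²`, `r = (1,1,0)`, shade `2` (the value changed, so both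
components are now required) and the only admissible centre is the point; blow up the point in chart `y` at `z = 1` —
residual `y²zw²`, `r = (2,0,0)`, shade `3 > 2`: a KANGAROO (at which the curve `C_{y,w}` is again admissible). Second conjunct: rule `bm` (which requires `E_z`) refuses
`C_{y,w}` at the second state. (computation) [cite: BierstoneMilman2002, Definitions 1.14] [cite: Hauser2010, §G] -/
theorem wh4_bmold_kangaroo_walk :
    walkTraceB 2 2 3 ⟨wh4F, [0, 0, 0], [], [], []⟩
        [([0, 1], 1, [0, 0, 0]), ([0, 2], 0, [0, 0, 1]), ([0, 1, 2], 0, [0, 1, 0])] =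
      [(3, [0, 0, 0], [], [], [[0, 1], [0, 2]]),
       (3, [0, 1, 0], [1], [], [[0, 2]]),
       (2, [1, 1, 0], [0, 1], [0, 1], [[0, 1, 2]]),
       (3, [2, 0, 0], [0], [0], [[0, 2]])] ∧
      admissible true 2 2 3 [([3, 1, 0], 1), ([1, 1, 2], 1)] [0, 1, 0] [1] [0, 2] = false := by
  decide

/-- The symmetric sibling (atlas path `/[yw]w:0,0,0/[yz]y:0,1,0/[yzw]y:0,0,1`): `C_{y,w}` first, then the released
curve `C_{y,z}` at `z = 1`, antelope `yz²w`, `r = (1,0,1)`, shade `2`, point blow-up at `w = 1` → `y²z²w`,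
`r = (2,0,0)`, shade `3`. (computation) [cite: BierstoneMilman2002, Definitions 1.14] [cite: Hauser2010, §G] -/
theorem wh4_bmold_kangaroo_walk_sibling :
    walkTraceB 2 2 3 ⟨wh4F, [0, 0, 0], [], [], []⟩
        [([0, 2], 2, [0, 0, 0]), ([0, 1], 0, [0, 1, 0]), ([0, 1, 2], 0, [0, 0, 1])] =
      [(3, [0, 0, 0], [], [], [[0, 1], [0, 2]]),
       (3, [0, 0, 1], [2], [], [[0, 1]]),
       (2, [1, 0, 1], [0, 2], [0, 2], [[0, 1, 2]]),
       (3, [2, 0, 0], [0], [0], [[0, 1]])] := by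
  decide

/-- Moh's bound at both new edges: `3 ≤ 2 + 2^0`. (computation) [cite: Moh1987, Stability Theorem] -/
theorem wh4_bmold_moh :
    BState.shade ⟨[([2, 1, 2], 1)], [2, 0, 0], [0], [], [0]⟩ ≤ BState.shade ⟨[([1, 1, 2], 1)], [1, 1, 0], [0, 1], [], [0, 1]⟩ + 1 ∧
      BState.shade ⟨[([2, 2, 1], 1)], [2, 0, 0], [0], [], [0]⟩ ≤ BState.shade ⟨[([1, 2, 1], 1)], [1, 0, 1], [0, 2], [], [0, 2]⟩ + 1 := by
  decide

end Literature.AlgebraicGeometry.Resolution.KangarooAtlasCert
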